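import Summits.QuantumAdvantage.QuantumAdvantage.Theorems.CubicForrelationNearExactIsExactTenBalancedA
import Summits.QuantumAdvantage.QuantumAdvantage.Theorems.CubicForrelationNearExactIsExactValueGranularity

/-!
# Crux `CubicForrelation.NearExactIsExact` (stmt-QuantumAdvantage-14043), line `direct-sum-amplification`, lead c6 cycle 3:
  stub `stub_mismatchBudget` — the f-side mismatch budget of the `n = 10` census

In the window `7/8 < Φ(f₁,g₁)` at `n = 10`, suppose `W_{g₁} = 32 p` (`p` odd) on the hyperplane `{x_last = bh}` and
`W_{g₁} = 16 v` (`v` odd) on its complement.  Writing `s_h(x) = (−1)^{f₁(x ‖ bh)}`, `s_l(x) = (−1)^{f₁(x ‖ ¬bh)}` and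
`M_h = #{x : s_h p < 0}`, `M_l = #{x : s_l v < 0}` for the two mismatch counts, we prove `4 M_h + 2 M_l < 128`.

Proof.  `2¹⁵ Φ = Σ_y (−1)^{f₁ y} W(y) = Σ_x [32 p s_h + 16 v s_l]` (`vg_two_pow_mul_forrelation` at `m = 5`, split along the
last coordinate with `tb_sum_snoc`), and Parseval `Σ_y W(y)² = 2²⁰` gives `Σ_x (1024 p² + 256 v²) = 2²⁰`.  Pointwise, for an
odd integer `z` and a sign `s = ±1`: `2 z s + 4·[z s < 0] ≤ z² + 1` and `4 z s + 8·[z s < 0] ≤ z² + 3` (elementary: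
`(|z| − 1)² ≥ 0`, `(|z| − 1)(|z| − 3) ≥ 0` for odd `|z|`, and `|z| ≥ 1` in the mismatch case).  Summing,
`2¹⁵ Φ ≤ 16 Σ p² + 4 Σ v² + 16·512 + 12·512 − 64 M_h − 32 M_l = 30720 − 64 M_h − 32 M_l`, and `Φ > 7/8` gives
`64 M_h + 32 M_l < 2048`.  Everything is proved from Mathlib and the tree (`tb_sum_snoc`, `sum_W_sq`,
`vg_two_pow_mul_forrelation`, `signOf_sq`); axioms are the standard three.
-/

set_option linter.dupNamespace false -- D-0017: single-problem summit ⇒ `QuantumAdvantage.QuantumAdvantage` by design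

noncomputable section

namespace Summit.QuantumAdvantage.QuantumAdvantage.Theorems.CubicForrelation.NearExactIsExact

open Finset
open Literature.Computability.QuantumComplexity
open Literature.Computability.QuantumComplexity.BuzetChailloux (signOf_sq)
open Literature.Computability.QuantumComplexity.DerivativeWalsh (W sum_W_sq)

/-! ### Pointwise arithmetic -/

/-- A sum over `Bool` read off at a chosen point and its negation. [folklore] -/
theorem mb_sum_bool (φ : Bool → ℝ) (bh : Bool) : ∑ b : Bool, φ b = φ bh + φ (!bh) := by
  rw [Fintype.sum_bool]
  cases bh
  · simp only [Bool.not_false]; ring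
  · simp only [Bool.not_true]

/-- For odd `z` and a sign `s = ±1`: `2 z s + 4·[z s < 0] ≤ z² + 1`. [folklore] -/
theorem mb_odd_half (z : ℤ) (hz : Odd z) (b : Bool) :
    2 * (signOf b * (z : ℝ)) + 4 * (if signOf b * (z : ℝ) < 0 then 1 else 0) ≤ (z : ℝ) ^ 2 + 1 := by
  -- reduce to an odd integer `t = ± z`
  obtain ⟨t, ht, hts⟩ : ∃ t : ℤ, Odd t ∧ signOf b * (z : ℝ) = t := by
    cases b
    · exact ⟨z, hz, by simp [signOf]⟩
    · exact ⟨-z, hz.neg, by simp [signOf]⟩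
  have hsq : (z : ℝ) ^ 2 = (t : ℝ) ^ 2 := by
    have h1 : (signOf b * (z : ℝ)) ^ 2 = (z : ℝ) ^ 2 := by rw [mul_pow, signOf_sq, one_mul]
    rw [← h1, hts]
  rw [hts, hsq]
  obtain ⟨m, rfl⟩ := ht
  split_ifs with hlt
  · have hm : m ≤ -1 := by
      have : ((2 * m + 1 : ℤ) : ℝ) < 0 := by exact_mod_cast hlt
      have : (2 * m + 1 : ℤ) < 0 := by exact_mod_cast this
      omega
    have h : (2 : ℤ) * (2 * m + 1) + 4 ≤ (2 * m + 1) ^ 2 + 1 := by nlinarith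
    have h' : ((2 : ℤ) * (2 * m + 1) + 4 : ℝ) ≤ (((2 * m + 1) ^ 2 + 1 : ℤ) : ℝ) := by exact_mod_cast h
    push_cast at h' ⊢
    linarith
  · have h : (2 : ℤ) * (2 * m + 1) ≤ (2 * m + 1) ^ 2 + 1 := by nlinarith
    have h' : (((2 : ℤ) * (2 * m + 1) : ℤ) : ℝ) ≤ (((2 * m + 1) ^ 2 + 1 : ℤ) : ℝ) := by exact_mod_cast h
    push_cast at h' ⊢
    linarith

/-- For odd `z` and a sign `s = ±1`: `4 z s + 8·[z s < 0] ≤ z² + 3`. [folklore] -/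
theorem mb_odd_quarter (z : ℤ) (hz : Odd z) (b : Bool) :
    4 * (signOf b * (z : ℝ)) + 8 * (if signOf b * (z : ℝ) < 0 then 1 else 0) ≤ (z : ℝ) ^ 2 + 3 := by
  obtain ⟨t, ht, hts⟩ : ∃ t : ℤ, Odd t ∧ signOf b * (z : ℝ) = t := by
    cases b
    · exact ⟨z, hz, by simp [signOf]⟩
    · exact ⟨-z, hz.neg, by simp [signOf]⟩
  have hsq : (z : ℝ) ^ 2 = (t : ℝ) ^ 2 := by
    have h1 : (signOf b * (z : ℝ)) ^ 2 = (z : ℝ) ^ 2 := by rw [mul_pow, signOf_sq, one_mul]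
    rw [← h1, hts]
  rw [hts, hsq]
  obtain ⟨m, rfl⟩ := ht
  split_ifs with hlt
  · have hm : m ≤ -1 := by
      have : ((2 * m + 1 : ℤ) : ℝ) < 0 := by exact_mod_cast hlt
      have : (2 * m + 1 : ℤ) < 0 := by exact_mod_cast this
      omega
    have h : (4 : ℤ) * (2 * m + 1) + 8 ≤ (2 * m + 1) ^ 2 + 3 := by nlinarith
    have h' : ((4 : ℤ) * (2 * m + 1) + 8 : ℝ) ≤ (((2 * m + 1) ^ 2 + 3 : ℤ) : ℝ) := by exact_mod_cast h
    push_cast at h' ⊢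
    linarith
  · have hm : 0 ≤ m := by
      have : ¬ ((2 * m + 1 : ℤ) : ℝ) < 0 := by exact_mod_cast hlt
      have : ¬ (2 * m + 1 : ℤ) < 0 := by exact_mod_cast this
      omega
    -- `(t − 1)(t − 3) = 4 m (m − 1) ≥ 0`
    have hmm : 0 ≤ m * (m - 1) := by
      rcases le_or_gt 1 m with h1 | h1
      · exact mul_nonneg hm (by omega)
      · have : m = 0 := by omega
        subst this; simp
    have h : (4 : ℤ) * (2 * m + 1) ≤ (2 * m + 1) ^ 2 + 3 := by nlinarith
    have h' : (((4 : ℤ) * (2 * m + 1) : ℤ) : ℝ) ≤ (((2 * m + 1) ^ 2 + 3 : ℤ) : ℝ) := by exact_mod_cast h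
    push_cast at h' ⊢
    linarith

/-! ### The mismatch budget -/

/-- **Mismatch budget.** In the window `7/8 < Φ(f₁,g₁)` at `n = 10`, if `W_{g₁} = 32 p` (`p` odd) on the hyperplane
`{x_last = bh}` and `W_{g₁} = 16 v` (`v` odd) off it, then the signs of `f₁` disagree with the signs of `p`, `v` on few
points: `4·#{x : (−1)^{f₁(x‖bh)} p(x) < 0} + 2·#{x : (−1)^{f₁(x‖¬bh)} v(x) < 0} < 128`.  (Cost identity: `2¹⁵Φ = Σ (32 p s_h +
16 v s_l)`, Parseval `Σ (1024 p² + 256 v²) = 2²⁰`, and the pointwise bounds `mb_odd_half`, `mb_odd_quarter`.) -/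
theorem stub_mismatchBudget :
    ∀ (f₁ g₁ : (Fin (4 + 4 + 1 + 1) → Bool) → Bool) (p v : (Fin (4 + 4 + 1) → Bool) → ℤ) (bh : Bool),
      7 / 8 < forrelation f₁ g₁ →
      (∀ x, W (fun y => signOf (g₁ y)) (Fin.snoc x bh) = 32 * (p x : ℝ)) → (∀ x, Odd (p x)) →
      (∀ x, W (fun y => signOf (g₁ y)) (Fin.snoc x (!bh)) = 16 * (v x : ℝ)) → (∀ x, Odd (v x)) →
      4 * ((univ.filter fun x : Fin (4 + 4 + 1) → Bool => signOf (f₁ (Fin.snoc x bh)) * (p x : ℝ) < 0).card : ℝ) +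
        2 * ((univ.filter fun x : Fin (4 + 4 + 1) → Bool => signOf (f₁ (Fin.snoc x (!bh))) * (v x : ℝ) < 0).card : ℝ) <
          128 := by
  intro f₁ g₁ p v bh hΦ hWh hp hWl hv
  -- the forrelation as a correlation with the Walsh transform, split along the last coordinate
  have hF : ∑ x, signOf (f₁ x) * W (fun y => signOf (g₁ y)) x = (2 : ℝ) ^ 15 * forrelation f₁ g₁ := by
    have h := vg_two_pow_mul_forrelation (m := 5) f₁ g₁
    norm_num at h ⊢
    exact h.symm
  have hFs := tb_sum_snoc (fun x => signOf (f₁ x) * W (fun y => signOf (g₁ y)) x)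
  rw [hF] at hFs
  simp only [mb_sum_bool _ bh, hWh, hWl] at hFs
  -- Parseval, split along the last coordinate
  have hP : ∑ x, W (fun y => signOf (g₁ y)) x ^ 2 = (2 : ℝ) ^ 20 := by
    rw [sum_W_sq]
    simp only [signOf_sq, Finset.sum_const, Finset.card_univ, Fintype.card_fun, Fintype.card_bool,
      Fintype.card_fin, nsmul_eq_mul, mul_one]
    norm_num
  have hPs := tb_sum_snoc (fun x => W (fun y => signOf (g₁ y)) x ^ 2)
  rw [hP] at hPs
  simp only [mb_sum_bool _ bh, hWh, hWl] at hPs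
  -- pointwise bounds, summed
  have hpt : ∀ x : Fin (4 + 4 + 1) → Bool,
      signOf (f₁ (Fin.snoc x bh)) * (32 * (p x : ℝ)) + signOf (f₁ (Fin.snoc x (!bh))) * (16 * (v x : ℝ)) ≤
        16 * (p x : ℝ) ^ 2 + 4 * (v x : ℝ) ^ 2 + 28 -
          64 * (if signOf (f₁ (Fin.snoc x bh)) * (p x : ℝ) < 0 then 1 else 0) -
          32 * (if signOf (f₁ (Fin.snoc x (!bh))) * (v x : ℝ) < 0 then 1 else 0) := by
    intro x
    have h1 := mb_odd_half (p x) (hp x) (f₁ (Fin.snoc x bh))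
    have h2 := mb_odd_quarter (v x) (hv x) (f₁ (Fin.snoc x (!bh)))
    linarith
  have hsum := Finset.sum_le_sum fun x (_ : x ∈ (univ : Finset (Fin (4 + 4 + 1) → Bool))) => hpt x
  rw [← hFs] at hsum
  simp only [Finset.sum_add_distrib, Finset.sum_sub_distrib, ← Finset.mul_sum, Finset.sum_const, Finset.card_univ,
    Fintype.card_fun, Fintype.card_bool, Fintype.card_fin, nsmul_eq_mul] at hsum
  simp only [Finset.sum_add_distrib, mul_pow, ← Finset.mul_sum] at hPs
  rw [Finset.natCast_card_filter, Finset.natCast_card_filter]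
  norm_num at hsum hPs ⊢
  linarith
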